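import Mathlib
import HarnessLib
import Summits.AtomisticToContinuum.FouriersLaw.Theses.JunctionLocality
import Summits.AtomisticToContinuum.FouriersLaw.Theorems.JunctionLocalitySuperadditiveResistanceDeviceLiouville
import Summits.AtomisticToContinuum.FouriersLaw.Theorems.JunctionLocalitySuperadditiveResistanceKuboGreen
import Summits.AtomisticToContinuum.FouriersLaw.Theorems.JunctionLocalitySuperadditiveResistanceStubBypassBoundAux2
import Summits.AtomisticToContinuum.FouriersLaw.Theorems.JunctionLocalitySuperadditiveResistanceStubDeviceForwardFieldsAux6
import Summits.AtomisticToContinuum.FouriersLaw.Theorems.JunctionLocalityConductanceLowerBoundStubRowSum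

/-!
# Dirichlet identity and transmission form of the RELOCATED forward field
(helper file `--supports` stmt-AtomisticToContinuum-11749 for the stubs `stub_relocPositiveConductance` (R3),
`stub_contactFormation` (R4), `stub_bulkStep` (R5) of line `cold-bath-relocation-walk`, crux
`JunctionLocality.ConductanceLowerBound`)

Setting: ONE `L`-site pinned anharmonic chain `P = pinnedChain ω₂ lam β γ` (all parameters `> 0`), its Gibbs state
`μ_T = P.gibbsMeasure L T` (`T > 0`), and the RELOCATED equilibrium generator with the hot thermostat on site `0` and the
cold thermostat on site `m < L`:
`L_m g = X_H g + γ (S_0 g + S_m g)` (`X_H = liouvilleOp P L`, `S_s = thermo L s T = T∂²_{p_s} − p_s ∂_{p_s}`).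
A relocated forward field is a classical `g ∈ C² ∩ L²(μ_T)` with `L_m g = −(p_0² − T)` pointwise
(`kin L 0 = p_0²`).  Write `∂_s = ∂_{p_s}`, `s[g] = ∫ g (p_0² − T) dμ_T`.

* `relocDirichlet_thermo_add_thermo_eq_bathOp` — the bridge `S_0 + S_m = S_{B_m}` with the site weights
  `B_m i = [i = 0] + [i = m]` (so that the landed general-weight Kubo toolkit applies; `m = 0` gives `B = 2·𝟙_0`).
* `integral_mul_source_eq_weightedDirichlet` — the CARRÉ DU CHAMP identity with the cutoff removed, for GENERAL weights
  `B ≥ 0`, any `σ`, friction `c > 0`: a classical `u ∈ C² ∩ L²(μ_T)` with `σ X_H u + c S_B u = −k`, `k ∈ L²(μ_T)`,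
  satisfies `∫ u k e^{−H/T} = c T Σ_i B_i ∫ (∂_i u)² e^{−H/T}` (the `n → ∞` limit of `Kubo.dirichlet_level`; the
  cutoff-gradient terms vanish by dominated convergence because `∂_i u ∈ L²(μ_T)` wherever `B_i > 0`,
  `Kubo.memLp_partialP`).  (adapted from `ForecastSensitivity.integral_mul_source_eq_dirichlet'`, `B` free.)
* `relocMemLpPartialP` — finite entropy production of relocated forward fields: `∂_0 g, ∂_m g ∈ L²(μ_T)`.
* `relocDirichlet` — `s[g] = γ T (‖∂_0 g‖² + ‖∂_m g‖²)` (norms in `L²(μ_T)`; correct for `m = 0` too).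
* `relocTransmissionForm` — the relocated Kubo conductance is a PERFECT SQUARE:
  `γ (1 − γ s[g] / T²) = (γ³/T) (‖p_0/γ − ∂_0 g‖² + ‖∂_m g‖²)`
  (Dirichlet identity + Gaussian projection `s[g] = T ⟨∂_0 g, p_0⟩`, `integral_mul_sq_sub_gibbsMeasure`, + equipartition
  `⟨p_0²⟩ = T`).  In particular `G ≥ 0`; strictness is the stub file R3.

References: Eckmann–Pillet–Rey-Bellet 1999 §3 (entropy production of the open chain); Rey-Bellet 2003 Rem. 4.4;
Kundu–Dhar–Narayan 2009 (conductance with a relocated bath); folklore.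
-/

noncomputable section

open MeasureTheory Filter Topology
open scoped ContDiff
open Literature.MathematicalPhysics.KineticTheory.HeatConduction
open Summit.AtomisticToContinuum.FouriersLaw.Theorems.SuperadditiveResistance.DeviceLiouville
  (kin kin_eq_sq continuous_kin thermo liouvilleOp bathOp)
open Summit.AtomisticToContinuum.FouriersLaw.Theorems.SuperadditiveResistance.Kubo
  (memLp_partialP chi dirichlet_level tendsto_integral_chi_mul tendsto_integral_partialP_chi_mul
    integrable_mul_mul_gibbsDensity integrable_sq_mul_gibbsDensity continuous_source)
open Summit.AtomisticToContinuum.FouriersLaw.Cruxes.SuperadditiveResistance.FloatingProbeBypassLaplacian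
  (pinnedChain_memLp_two_snd pinnedChain_memLp_two_snd_sq pinnedChain_integral_snd_sq
    integral_mul_sq_sub_gibbsMeasure pinnedChain_memLp_two_kin)
open Summit.AtomisticToContinuum.FouriersLaw.Cruxes.ConductanceLowerBound.ForecastSensitivity (sum_ite_val_eq)

namespace Summit.AtomisticToContinuum.FouriersLaw.Cruxes.ConductanceLowerBound.ColdBathRelocationWalk

/-! ## The relocated weights `B_m = 𝟙_0 + 𝟙_m` -/

section Weights

variable {L : ℕ}

/-- The two single-site thermostats are the weighted bath operator of `B_m i = [i=0] + [i=m]`: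
`S_0 f + S_m f = S_{B_m} f`. [folklore] -/
theorem relocDirichlet_thermo_add_thermo_eq_bathOp (L m : ℕ) (T : ℝ) (f : PhaseSpace L → ℝ) (x : PhaseSpace L) :
    thermo L 0 T f x + thermo L m T f x =
      bathOp L (fun i : Fin L => (if i.val = 0 then (1 : ℝ) else 0) + (if i.val = m then 1 else 0)) T f x := by
  unfold bathOp thermo
  rw [← Finset.sum_add_distrib]
  refine Finset.sum_congr rfl fun i _ => ?_
  dsimp only
  split_ifs <;> ring

/-- The relocated weights are non-negative. [folklore] -/
theorem relocDirichlet_weight_nonneg (L m : ℕ) (i : Fin L) :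
    0 ≤ (if i.val = 0 then (1 : ℝ) else 0) + (if i.val = m then 1 else 0) := by
  split_ifs <;> norm_num

/-- The relocated weights charge site `0`. [folklore] -/
theorem relocDirichlet_weight_pos_zero {L : ℕ} (hL : 0 < L) (m : ℕ) :
    0 < (if (⟨0, hL⟩ : Fin L).val = 0 then (1 : ℝ) else 0) + (if (⟨0, hL⟩ : Fin L).val = m then 1 else 0) := by
  have h0 : ((⟨0, hL⟩ : Fin L).val = 0) := rfl
  rw [if_pos h0]
  split_ifs <;> norm_num

/-- The relocated weights charge site `m`. [folklore] -/
theorem relocDirichlet_weight_pos_site {L m : ℕ} (hm : m < L) :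
    0 < (if (⟨m, hm⟩ : Fin L).val = 0 then (1 : ℝ) else 0) + (if (⟨m, hm⟩ : Fin L).val = m then 1 else 0) := by
  have h0 : ((⟨m, hm⟩ : Fin L).val = m) := rfl
  rw [if_pos h0]
  split_ifs <;> norm_num

/-- `Σ_i ([i=0] + [i=m]) a_i = a_0 + a_m` (two applications of the landed `ForecastSensitivity.sum_ite_val_eq`).
[folklore] -/
theorem relocDirichlet_sum_weight_mul {m : ℕ} (hL : 0 < L) (hm : m < L) (a : Fin L → ℝ) :
    ∑ i : Fin L, ((if i.val = 0 then (1 : ℝ) else 0) + (if i.val = m then 1 else 0)) * a i =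
      a ⟨0, hL⟩ + a ⟨m, hm⟩ := by
  simp only [add_mul, Finset.sum_add_distrib, ite_mul, one_mul, zero_mul]
  rw [sum_ite_val_eq hL, sum_ite_val_eq hm]

end Weights

/-! ## Carré du champ with general weights, cutoff removed -/

section DirichletLimit

variable {ω₂ lam β γ : ℝ} {L : ℕ}

/-- **Carré du champ, cutoff removed, general weights.** For the pinned chain (`ω₂ > 0`, `lam, β ≥ 0`), `T > 0`,
weights `B ≥ 0`, any `σ`, friction `c > 0`, and a classical solution `u ∈ C² ∩ L²(μ_T)` of `σ X_H u + c S_B u = −k`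
with `k ∈ L²(μ_T)`:  `∫ u k e^{−H/T} = c T Σ_i B_i ∫ (∂_{p_i} u)² e^{−H/T}` — the `n → ∞` limit of
`Kubo.dirichlet_level`. (adapted from `ForecastSensitivity.integral_mul_source_eq_dirichlet'`) [folklore] -/
theorem integral_mul_source_eq_weightedDirichlet (hω : 0 < ω₂) (hl : 0 ≤ lam) (hβ : 0 ≤ β) {T : ℝ}
    (hT : 0 < T) (B : Fin L → ℝ) (hBnn : ∀ i, 0 ≤ B i) (σ : ℝ) {c : ℝ} (hc : 0 < c)
    {u k : PhaseSpace L → ℝ} (hu : ContDiff ℝ 2 u)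
    (hu2 : MemLp u 2 ((pinnedChain ω₂ lam β γ).gibbsMeasure L T))
    (hk2 : MemLp k 2 ((pinnedChain ω₂ lam β γ).gibbsMeasure L T))
    (hpde : ∀ x, σ * liouvilleOp (pinnedChain ω₂ lam β γ) L u x + c * bathOp L B T u x = -k x) :
    ∫ x, u x * k x * (pinnedChain ω₂ lam β γ).gibbsDensity L T x =
      c * T * ∑ i : Fin L, B i * ∫ x, partialP i u x ^ 2 * (pinnedChain ω₂ lam β γ).gibbsDensity L T x := by
  set P := pinnedChain ω₂ lam β γ with hP
  have hkc : Continuous k := continuous_source B T σ c hu hpde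
  have hu1 : ContDiff ℝ 1 u := hu.of_le (by norm_cast)
  have huc : Continuous u := hu.continuous
  have hduc : ∀ i, Continuous (partialP i u) := fun i => continuous_partialP hu1 one_ne_zero i
  -- the identity at cutoff level `n`
  have hlevel : ∀ n : ℕ, (∫ x, chi P L n x * u x * k x * P.gibbsDensity L T x) -
      c * T * ∑ i, B i * ∫ x, u x * partialP i (chi P L n) x * partialP i u x * P.gibbsDensity L T x =
      c * T * ∑ i, B i * ∫ x, chi P L n x * partialP i u x ^ 2 * P.gibbsDensity L T x :=
    fun n => (dirichlet_level hω hl hβ γ L hT B σ c hu hpde n).symm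
  -- finite entropy production at the weighted sites
  have hdu2 : ∀ {i : Fin L}, 0 < B i → MemLp (partialP i u) 2 (P.gibbsMeasure L T) := fun {i} hi =>
    memLp_partialP hω hl hβ γ L hT B hBnn σ hc hu hu2 hk2 hpde hi
  -- the source term converges
  have hukL1 : Integrable fun x => u x * k x * P.gibbsDensity L T x :=
    integrable_mul_mul_gibbsDensity hω hl hβ γ L hT hu2 hk2
  have hlim1 : Tendsto (fun n : ℕ => ∫ x, chi P L n x * u x * k x * P.gibbsDensity L T x) atTop
      (𝓝 (∫ x, u x * k x * P.gibbsDensity L T x)) := by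
    refine (tendsto_integral_chi_mul hω.le hl hβ γ L T (F := fun x => u x * k x)
      (huc.mul hkc).aestronglyMeasurable hukL1).congr fun n => ?_
    exact integral_congr_ae (ae_of_all _ fun x => by ring)
  -- the cutoff-gradient terms vanish
  have hlimE : ∀ i : Fin L, Tendsto (fun n : ℕ => B i * ∫ x, u x * partialP i (chi P L n) x *
      partialP i u x * P.gibbsDensity L T x) atTop (𝓝 0) := by
    intro i
    rcases (hBnn i).eq_or_lt with hi | hi
    · rw [← hi]
      simp only [zero_mul]
      exact tendsto_const_nhds
    · have hF : Integrable fun x => u x * partialP i u x * P.gibbsDensity L T x :=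
        integrable_mul_mul_gibbsDensity hω hl hβ γ L hT hu2 (hdu2 hi)
      have h0 := tendsto_integral_partialP_chi_mul hω hl hβ γ L T i (F := fun x => u x * partialP i u x)
        (huc.mul (hduc i)).aestronglyMeasurable hF
      have h1 := h0.const_mul (B i)
      rw [mul_zero] at h1
      refine h1.congr fun n => ?_
      congr 1
      exact integral_congr_ae (ae_of_all _ fun x => by ring)
  -- the cut-off Dirichlet energies converge
  have hlimD : ∀ i : Fin L, Tendsto (fun n : ℕ => B i * ∫ x, chi P L n x * partialP i u x ^ 2 *
      P.gibbsDensity L T x) atTop (𝓝 (B i * ∫ x, partialP i u x ^ 2 * P.gibbsDensity L T x)) := by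
    intro i
    rcases (hBnn i).eq_or_lt with hi | hi
    · rw [← hi]
      simp only [zero_mul]
      exact tendsto_const_nhds
    · have hF : Integrable fun x => partialP i u x ^ 2 * P.gibbsDensity L T x :=
        integrable_sq_mul_gibbsDensity hω hl hβ γ L hT (hdu2 hi)
      exact (tendsto_integral_chi_mul hω.le hl hβ γ L T (F := fun x => partialP i u x ^ 2)
        ((hduc i).pow 2).aestronglyMeasurable hF).const_mul (B i)
  have hLft : Tendsto (fun n : ℕ => (∫ x, chi P L n x * u x * k x * P.gibbsDensity L T x) -
      c * T * ∑ i, B i * ∫ x, u x * partialP i (chi P L n) x * partialP i u x * P.gibbsDensity L T x)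
      atTop (𝓝 ((∫ x, u x * k x * P.gibbsDensity L T x) - c * T * 0)) := by
    have hs := tendsto_finsetSum (Finset.univ : Finset (Fin L)) fun i _ => hlimE i
    rw [Finset.sum_const_zero] at hs
    exact hlim1.sub (hs.const_mul (c * T))
  have hRgt : Tendsto (fun n : ℕ => c * T * ∑ i, B i * ∫ x, chi P L n x * partialP i u x ^ 2 *
      P.gibbsDensity L T x) atTop
      (𝓝 (c * T * ∑ i, B i * ∫ x, partialP i u x ^ 2 * P.gibbsDensity L T x)) :=
    (tendsto_finsetSum (Finset.univ : Finset (Fin L)) fun i _ => hlimD i).const_mul (c * T)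
  have heq := tendsto_nhds_unique (hLft.congr hlevel) hRgt
  rw [mul_zero, sub_zero] at heq
  exact heq

end DirichletLimit

/-! ## The relocated forward field: entropy production, Dirichlet identity, transmission form -/

section Relocated

/-- The relocated PDE `X_H g + γ(S_0 + S_m) g = −(p_0² − T)` in the weighted pair form
`1·X_H g + γ S_{B_m} g = −(kin L 0 − T)` used by the Kubo toolkit. [folklore] -/
theorem relocDirichlet_pair {ω₂ lam β γ T : ℝ} {L m : ℕ} {g : PhaseSpace L → ℝ}
    (hpde : ∀ x, liouvilleOp (pinnedChain ω₂ lam β γ) L g x + γ * (thermo L 0 T g x + thermo L m T g x) =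
      -(kin L 0 x - T)) (x : PhaseSpace L) :
    1 * liouvilleOp (pinnedChain ω₂ lam β γ) L g x +
      γ * bathOp L (fun i : Fin L => (if i.val = 0 then (1 : ℝ) else 0) + (if i.val = m then 1 else 0)) T g x =
      -(kin L 0 x - T) := by
  rw [one_mul, ← relocDirichlet_thermo_add_thermo_eq_bathOp]
  exact hpde x

/-- **Finite entropy production of relocated forward fields.** For all parameters `> 0`, `T > 0`, `m < L` and every
classical `C² ∩ L²(μ_T)` solution `g` of `X_H g + γ(S_0 + S_m) g = −(p_0² − T)`: `∂_{p_0} g ∈ L²(μ_T)` and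
`∂_{p_m} g ∈ L²(μ_T)` (`Kubo.memLp_partialP` at the two weighted sites of `B_m = 𝟙_0 + 𝟙_m`). [folklore] -/
theorem relocMemLpPartialP :
    ∀ (ω₂ lam β γ T : ℝ), 0 < ω₂ → 0 < lam → 0 < β → 0 < γ → 0 < T →
      ∀ (L m : ℕ) (hL : 0 < L) (hm : m < L) (g : PhaseSpace L → ℝ), ContDiff ℝ 2 g →
        MemLp g 2 ((pinnedChain ω₂ lam β γ).gibbsMeasure L T) →
        (∀ x, liouvilleOp (pinnedChain ω₂ lam β γ) L g x + γ * (thermo L 0 T g x + thermo L m T g x) =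
          -(kin L 0 x - T)) →
        MemLp (partialP ⟨0, hL⟩ g) 2 ((pinnedChain ω₂ lam β γ).gibbsMeasure L T) ∧
          MemLp (partialP ⟨m, hm⟩ g) 2 ((pinnedChain ω₂ lam β γ).gibbsMeasure L T) := by
  intro ω₂ lam β γ T hω hl hβ hγ hT L m hL hm g hgC hgL2 hpde
  haveI := pinnedChain_isProbabilityMeasure_gibbsMeasure hω hl.le hβ.le γ L hT
  have hk0L2 : MemLp (fun x => kin L 0 x - T) 2 ((pinnedChain ω₂ lam β γ).gibbsMeasure L T) :=
    (pinnedChain_memLp_two_kin hω hl.le hβ.le γ L 0 hT).sub (memLp_const T)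
  have hpg := relocDirichlet_pair hpde
  exact ⟨memLp_partialP hω hl.le hβ.le γ L hT _ (relocDirichlet_weight_nonneg L m) 1 hγ hgC hgL2 hk0L2 hpg
      (relocDirichlet_weight_pos_zero hL m),
    memLp_partialP hω hl.le hβ.le γ L hT _ (relocDirichlet_weight_nonneg L m) 1 hγ hgC hgL2 hk0L2 hpg
      (relocDirichlet_weight_pos_site hm)⟩

/-- **Dirichlet identity of the relocated forward field.** For all parameters `> 0`, `T > 0`, `m < L` and every
classical `C² ∩ L²(μ_T)` solution `g` of `X_H g + γ(S_0 + S_m) g = −(p_0² − T)`: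
`∫ g (p_0² − T) dμ_T = γ T (∫ (∂_{p_0} g)² dμ_T + ∫ (∂_{p_m} g)² dμ_T)` — the Kubo pairing of the field with its own
source is the entropy production at the two thermostats (for `m = 0` both terms are `‖∂_{p_0} g‖²`, weight `2`).
[folklore] -/
theorem relocDirichlet :
    ∀ (ω₂ lam β γ T : ℝ), 0 < ω₂ → 0 < lam → 0 < β → 0 < γ → 0 < T →
      ∀ (L m : ℕ) (hL : 0 < L) (hm : m < L) (g : PhaseSpace L → ℝ), ContDiff ℝ 2 g →
        MemLp g 2 ((pinnedChain ω₂ lam β γ).gibbsMeasure L T) →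
        (∀ x, liouvilleOp (pinnedChain ω₂ lam β γ) L g x + γ * (thermo L 0 T g x + thermo L m T g x) =
          -(kin L 0 x - T)) →
        ∫ x, g x * (kin L 0 x - T) ∂((pinnedChain ω₂ lam β γ).gibbsMeasure L T) =
          γ * T * ((∫ x, (partialP ⟨0, hL⟩ g x) ^ 2 ∂((pinnedChain ω₂ lam β γ).gibbsMeasure L T)) +
            ∫ x, (partialP ⟨m, hm⟩ g x) ^ 2 ∂((pinnedChain ω₂ lam β γ).gibbsMeasure L T)) := by
  intro ω₂ lam β γ T hω hl hβ hγ hT L m hL hm g hgC hgL2 hpde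
  set P := pinnedChain ω₂ lam β γ with hP
  haveI : IsProbabilityMeasure (P.gibbsMeasure L T) :=
    pinnedChain_isProbabilityMeasure_gibbsMeasure hω hl.le hβ.le γ L hT
  have hk0L2 : MemLp (fun x => kin L 0 x - T) 2 (P.gibbsMeasure L T) :=
    (pinnedChain_memLp_two_kin hω hl.le hβ.le γ L 0 hT).sub (memLp_const T)
  have hDρ := integral_mul_source_eq_weightedDirichlet hω hl.le hβ.le hT _ (relocDirichlet_weight_nonneg L m) 1 hγ
    hgC hgL2 hk0L2 (relocDirichlet_pair hpde)
  rw [relocDirichlet_sum_weight_mul hL hm (fun i => ∫ x, partialP i g x ^ 2 * P.gibbsDensity L T x)] at hDρ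
  rw [P.integral_gibbsMeasure, P.integral_gibbsMeasure, P.integral_gibbsMeasure, hDρ]
  ring

/-- **Transmission form of the relocated Kubo conductance (a perfect square).** For all parameters `> 0`, `T > 0`,
`m < L` and every classical `C² ∩ L²(μ_T)` solution `g` of `X_H g + γ(S_0 + S_m) g = −(p_0² − T)`:
`γ (1 − (γ/T²) ∫ g (p_0² − T) dμ_T) = (γ³/T) (∫ (p_0/γ − ∂_{p_0} g)² dμ_T + ∫ (∂_{p_m} g)² dμ_T)`
(Dirichlet identity `relocDirichlet`, Gaussian projection `∫ g (p_0² − T) dμ_T = T ∫ ∂_{p_0} g · p_0 dμ_T` and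
equipartition `∫ p_0² dμ_T = T`).  Hence the relocated conductance is `≥ 0`. [folklore] -/
theorem relocTransmissionForm :
    ∀ (ω₂ lam β γ T : ℝ), 0 < ω₂ → 0 < lam → 0 < β → 0 < γ → 0 < T →
      ∀ (L m : ℕ) (hL : 0 < L) (hm : m < L) (g : PhaseSpace L → ℝ), ContDiff ℝ 2 g →
        MemLp g 2 ((pinnedChain ω₂ lam β γ).gibbsMeasure L T) →
        (∀ x, liouvilleOp (pinnedChain ω₂ lam β γ) L g x + γ * (thermo L 0 T g x + thermo L m T g x) =
          -(kin L 0 x - T)) →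
        γ * (1 - γ / T ^ 2 * ∫ x, g x * (kin L 0 x - T) ∂((pinnedChain ω₂ lam β γ).gibbsMeasure L T)) =
          γ ^ 3 / T * ((∫ x, (x.2 ⟨0, hL⟩ / γ - partialP ⟨0, hL⟩ g x) ^ 2 ∂((pinnedChain ω₂ lam β γ).gibbsMeasure L T)) +
            ∫ x, (partialP ⟨m, hm⟩ g x) ^ 2 ∂((pinnedChain ω₂ lam β γ).gibbsMeasure L T)) := by
  intro ω₂ lam β γ T hω hl hβ hγ hT L m hL hm g hgC hgL2 hpde
  set P := pinnedChain ω₂ lam β γ with hP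
  set μ := P.gibbsMeasure L T with hμ
  set i0 : Fin L := ⟨0, hL⟩ with hi0
  set im : Fin L := ⟨m, hm⟩ with him
  haveI : IsProbabilityMeasure μ := pinnedChain_isProbabilityMeasure_gibbsMeasure hω hl.le hβ.le γ L hT
  obtain ⟨ha0L2, hamL2⟩ := relocMemLpPartialP ω₂ lam β γ T hω hl hβ hγ hT L m hL hm g hgC hgL2 hpde
  have hgd : Differentiable ℝ g := hgC.differentiable two_ne_zero
  have hpL2 : MemLp (fun x : PhaseSpace L => x.2 i0) 2 μ := pinnedChain_memLp_two_snd hω hl.le hβ.le γ L hT i0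
  -- (D) Dirichlet identity
  have hD := relocDirichlet ω₂ lam β γ T hω hl hβ hγ hT L m hL hm g hgC hgL2 hpde
  -- (P) Gaussian projection
  have hA : ∫ x, g x * (kin L 0 x - T) ∂μ = T * ∫ x, partialP i0 g x * x.2 i0 ∂μ := by
    rw [← integral_mul_sq_sub_gibbsMeasure hω hl.le hβ.le γ L hT i0 hgd hgL2 ha0L2]
    exact integral_congr_ae (ae_of_all _ fun x => by dsimp only; rw [kin_eq_sq hL])
  -- equipartition
  have hE : ∫ x, x.2 i0 ^ 2 ∂μ = T := pinnedChain_integral_snd_sq hω hl.le hβ.le γ L hT i0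
  -- expand the square
  have i1 : Integrable (fun x : PhaseSpace L => x.2 i0 ^ 2) μ := hpL2.integrable_sq
  have i2 : Integrable (fun x => partialP i0 g x * x.2 i0) μ := ha0L2.integrable_mul hpL2
  have i3 : Integrable (fun x => partialP i0 g x ^ 2) μ := ha0L2.integrable_sq
  have hY : ∫ x, (x.2 i0 / γ - partialP i0 g x) ^ 2 ∂μ =
      (1 / γ ^ 2) * (∫ x, x.2 i0 ^ 2 ∂μ) - (2 / γ) * (∫ x, partialP i0 g x * x.2 i0 ∂μ) +
        ∫ x, partialP i0 g x ^ 2 ∂μ := by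
    have e1 : ∫ x, (x.2 i0 / γ - partialP i0 g x) ^ 2 ∂μ =
        ∫ x, ((1 / γ ^ 2) * x.2 i0 ^ 2 - (2 / γ) * (partialP i0 g x * x.2 i0) + partialP i0 g x ^ 2) ∂μ :=
      integral_congr_ae (ae_of_all _ fun x => by ring)
    have i12 : Integrable (fun x => (1 / γ ^ 2) * x.2 i0 ^ 2 - (2 / γ) * (partialP i0 g x * x.2 i0)) μ :=
      (i1.const_mul _).sub (i2.const_mul _)
    rw [e1, integral_add i12 i3, integral_sub (i1.const_mul _) (i2.const_mul _), integral_const_mul,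
      integral_const_mul]
  rw [hY, hE]
  have hγ0 : γ ≠ 0 := hγ.ne'
  have hT0 : T ≠ 0 := hT.ne'
  -- `s = T J` and `s = γ T (A0 + Am)`
  set s := ∫ x, g x * (kin L 0 x - T) ∂μ with hs
  set J := ∫ x, partialP i0 g x * x.2 i0 ∂μ with hJ
  set A0 := ∫ x, partialP i0 g x ^ 2 ∂μ with hA0
  set Am := ∫ x, partialP im g x ^ 2 ∂μ with hAm
  have hAsum : A0 + Am = J / γ := by
    have h1 : γ * T * (A0 + Am) = T * J := by rw [← hD, ← hA]
    field_simp
    nlinarith [h1, hT]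
  have hAm' : Am = J / γ - A0 := by linarith
  rw [hA, hAm']
  field_simp
  ring

end Relocated

end Summit.AtomisticToContinuum.FouriersLaw.Cruxes.ConductanceLowerBound.ColdBathRelocationWalk

end
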